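import Summits.CriticalPhenomena.PercolationContinuityZ3.Theorems.PercNearOneGluingNoHeavyQuantKnConstants
import Summits.CriticalPhenomena.PercolationContinuityZ3.Theorems.PercNearOneGluingNoHeavyQuantPkConstants
import HarnessLib

/-!
# QUANT lane / PAPER-2 rate track (ARM-2 = constants bookkeeper, gen 3): the tolerance cascade of the effective
# Kozma–Nitzan criterion as a FUNCTION OF THE PEIERLS CONSTANT `ε`, and the two-sided bracket
# `log₂(1/η_d(2⁻ᵃ)) = d·2^d · (6a + 2 log₂(a+3) + 4 log₂(d+1) + θ)`, `θ ∈ [50, 53]` — "six bits of base per bit of `ε`, times `d·2^d`"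

builds on p205010 (kernel theorem, internal audit signed; external expert review pending)

Cell `prim-quant`, seat `prim-quant-arm-2` (constants bookkeeper), ledger `run/shared/lean/prim/quant/prim-quant-arm-2/RATE-CONSTANTS.md`
§2 ("Sensitivity: ∂log₂(1/η)/∂log₂(1/ε) ≈ 6·d·2^d") and §8 (levers table).  The tree carries the cascade twice, at two FIXED Peierls
constants: `kn*` (`…QuantKnConstants`, `ε = 2⁻³²`, the history-driven site renormalisation) and `pk*` (`…QuantPkConstants`, `ε = 2⁻⁸`,
the `★`-animal Peierls driver of arm-1).  This file states the cascade ONCE with `ε` a parameter —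

  `K(ε) = max(64, ⌈log(8/ε)·32/ε⌉)`, `δ_corr(ε, d) = ε/(96(d+1))`, `δ(ε) = ε/192`, `τ₁ = min(δ², δ_corr²)`, `δ_E = τ₁/(200 K)`,
  `τ_U = δ_E²/2`, and the ORBIT DEFECT `η(ε, d) = τ_U^{d·2^d}`

— proves that the two fixed families ARE its instances (`knK = epsK knEps`, `knTauU d = epsTauU knEps d`, `pkTauU d = epsTauU pkEps d`,
all `rfl`), the closed form `τ_U(ε, d) = ε⁴ / (2·(96(d+1))⁴·(200 K(ε))²)` (`d ≥ 1`), MONOTONICITY (`0 < ε ≤ ε' ≤ 8 ⇒ K(ε') ≤ K(ε)` and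
`τ_U(ε, d) ≤ τ_U(ε', d)`: a better Peierls constant can only raise the defect), and the uniform two-sided BRACKET at dyadic `ε = 2⁻ᵃ`:

  `(a+3)·2^{a+4} < K(2⁻ᵃ) ≤ (a+3)·2^{a+5}`,
  `2^{-(6a+53)} / ((d+1)⁴ (a+3)²) ≤ τ_U(2⁻ᵃ, d) ≤ 2^{-(6a+50)} / ((d+1)⁴ (a+3)²)`          (every `a`, every `d ≥ 1`),

hence the same bracket raised to the power `d·2^d` for the orbit defect.  Reading: `log₂(1/η_d(2⁻ᵃ)) = d·2^d·(6a + 2log₂(a+3) +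
4log₂(d+1) + θ)` with `50 ≤ θ ≤ 53`; at `d = 3` (`d·2^d = 24`): `a = 32` gives `[6246, 6318] ∋ 6283.9` (kernel: `2⁻⁶²⁸⁴ < knTauU 3^24 <
2⁻⁶²⁸³`, p213333) and `a = 8` gives `[2710, 2782] ∋ 2747.7` (kernel: `2⁻²⁷⁴⁸ < pkTauU 3^24 < 2⁻²⁷⁴⁷`, p245966).  So every bit won on the
Peierls constant of the renormalisation is worth exactly `6·d·2^d` bits of the printed base (`144` at `d = 3`), uniformly, and nothing
else in the cascade moves: this is the levers table of the ledger as ONE kernel statement, ready for any future driver threshold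
(Liggett–Schonmann–Stacey domination `ε ≈ 0.4`: `≈ 24·(8 + 4 + 8 + 51.6) ≈ 1720` bits at `d = 3`).  CLASS OF THE RATE UNCHANGED (iterated
logarithm: the scale function is untouched); honest sentence unchanged; nothing here is a new rate at `p_c`.
[cite: KozmaNitzan2024, §4 Lemmas 10–12 and Theorem 6 (pp. 17–31)] [cite: DuminilcopinKozmaTassion2020, Proposition 1]
-/

noncomputable section

namespace Summit.CriticalPhenomena.PercolationContinuityZ3.Theorems.Quant

open Literature.Probability.Percolation Literature.Probability.LatticeModels

variable {d : ℕ}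

/-! ## The cascade with the Peierls constant `ε` a parameter -/

/-- The number of stub levels `K(ε) = max(64, ⌈log(8/ε)·32/ε⌉)` (`(1 - ε/32)^K ≤ ε/8`). [cite: KozmaNitzan2024, §4 p. 26 (the constant K)] -/
def epsK (ε : ℝ) : ℕ := max 64 ⌈Real.log (8 / ε) * (32 / ε)⌉₊

/-- Lemma 12's internal tolerance `δ_corr(ε, d) = ε/(96(d+1))`. [cite: KozmaNitzan2024, §4 Lemma 12] -/
def epsDeltaCorr (ε : ℝ) (d : ℕ) : ℝ := ε / (96 * ((d : ℝ) + 1))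

/-- Lemma 10's internal tolerance for the aspect-`2K` targets, `δ(ε) = ε/192`. [cite: KozmaNitzan2024, §4 Lemma 10] -/
def epsDelta (ε : ℝ) : ℝ := ε / 192

/-- `τ₁(ε, d) = min(δ², δ_corr²)`, the finest target-lemma tolerance. [folklore] -/
def epsTau1 (ε : ℝ) (d : ℕ) : ℝ := min (epsDelta ε ^ 2) (epsDeltaCorr ε d ^ 2)

/-- `δ_E(ε, d) = τ₁/(200 K)`, the internal tolerance of Lemma 11's target steps. [cite: KozmaNitzan2024, §4 Lemma 11] -/
def epsDeltaE (ε : ℝ) (d : ℕ) : ℝ := epsTau1 ε d / (200 * (epsK ε : ℝ))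

/-- `τ_U(ε, d) = δ_E²/2`, the uniqueness-zone tolerance. [cite: DuminilcopinKozmaTassion2020, Proposition 1] -/
def epsTauU (ε : ℝ) (d : ℕ) : ℝ := epsDeltaE ε d ^ 2 / 2

/-- **The orbit defect** `η(ε, d) = τ_U^{d·2^d}` (FKG square-root trick over the `d·2^d` quarter-face targets of one orbit). [folklore] -/
def epsOrbitDefect (ε : ℝ) (d : ℕ) : ℝ := epsTauU ε d ^ (d * 2 ^ d)

/-! ## The two fixed cascades of the tree are instances -/

/-- `knEps = 2⁻³²`. [folklore] -/
theorem knEps_eq : knEps = (1 / 2) ^ 32 := rfl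
/-- `pkEps = 2⁻⁸`. [folklore] -/
theorem pkEps_eq : pkEps = (1 / 2) ^ 8 := rfl
/-- `knK = K(knEps)`. [folklore] -/
theorem knK_eq_epsK : knK = epsK knEps := rfl
/-- `pkK = K(pkEps)`. [folklore] -/
theorem pkK_eq_epsK : pkK = epsK pkEps := rfl
/-- `knDeltaE d = δ_E(knEps, d)`. [folklore] -/
theorem knDeltaE_eq_epsDeltaE (d : ℕ) : knDeltaE d = epsDeltaE knEps d := rfl
/-- `pkDeltaE d = δ_E(pkEps, d)`. [folklore] -/
theorem pkDeltaE_eq_epsDeltaE (d : ℕ) : pkDeltaE d = epsDeltaE pkEps d := rfl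
/-- `knTauU d = τ_U(knEps, d)`. [folklore] -/
theorem knTauU_eq_epsTauU (d : ℕ) : knTauU d = epsTauU knEps d := rfl
/-- `pkTauU d = τ_U(pkEps, d)`. [folklore] -/
theorem pkTauU_eq_epsTauU (d : ℕ) : pkTauU d = epsTauU pkEps d := rfl
/-- The tree's `d = 3` orbit defect is `η(2⁻³², 3)`: `knTauU 3 ^ 24 = epsOrbitDefect knEps 3`. [folklore] -/
theorem knTauU_three_pow_eq : knTauU 3 ^ 24 = epsOrbitDefect knEps 3 := rfl
/-- The Peierls-lever `d = 3` orbit defect is `η(2⁻⁸, 3)`: `pkTauU 3 ^ 24 = epsOrbitDefect pkEps 3`. [folklore] -/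
theorem pkTauU_three_pow_eq : pkTauU 3 ^ 24 = epsOrbitDefect pkEps 3 := rfl

/-! ## Positivity and the closed form -/

/-- `64 ≤ K(ε)`. [folklore] -/
theorem epsK_ge (ε : ℝ) : 64 ≤ epsK ε := le_max_left _ _
/-- `0 < K(ε)`. [folklore] -/
theorem epsK_pos (ε : ℝ) : 0 < epsK ε := lt_of_lt_of_le (by norm_num) (epsK_ge ε)

/-- For `d ≥ 1` the corridor tolerance is the finer one: `δ_corr(ε,d)² ≤ δ(ε)²` (any real `ε`). [folklore] -/
theorem epsDeltaCorr_sq_le (hd : 1 ≤ d) (ε : ℝ) : epsDeltaCorr ε d ^ 2 ≤ epsDelta ε ^ 2 := by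
  unfold epsDeltaCorr epsDelta
  have hd' : (1 : ℝ) ≤ d := by exact_mod_cast hd
  rw [div_pow, div_pow]
  have h192 : (192 : ℝ) ^ 2 ≤ (96 * ((d : ℝ) + 1)) ^ 2 := by nlinarith
  exact div_le_div_of_nonneg_left (sq_nonneg ε) (by positivity) h192

/-- For `d ≥ 1`: `τ₁(ε, d) = δ_corr(ε, d)²`. [folklore] -/
theorem epsTau1_eq (hd : 1 ≤ d) (ε : ℝ) : epsTau1 ε d = epsDeltaCorr ε d ^ 2 :=
  min_eq_right (epsDeltaCorr_sq_le hd ε)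

/-- **Closed form**, `d ≥ 1`: `τ_U(ε, d) = ε⁴ / (2 · (96(d+1))⁴ · (200 K(ε))²)`. [folklore] -/
theorem epsTauU_eq_closedForm (hd : 1 ≤ d) (ε : ℝ) :
    epsTauU ε d = ε ^ 4 / (2 * (96 * ((d : ℝ) + 1)) ^ 4 * (200 * (epsK ε : ℝ)) ^ 2) := by
  unfold epsTauU epsDeltaE
  rw [epsTau1_eq hd]
  unfold epsDeltaCorr
  have hK0 : (0 : ℝ) < epsK ε := by exact_mod_cast epsK_pos ε
  have hd0 : (0 : ℝ) < 96 * ((d : ℝ) + 1) := by positivity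
  field_simp

/-- `0 < τ_U(ε, d)` for `ε ≠ 0`, `d ≥ 1`. [folklore] -/
theorem epsTauU_pos (hd : 1 ≤ d) {ε : ℝ} (hε : ε ≠ 0) : 0 < epsTauU ε d := by
  rw [epsTauU_eq_closedForm hd]
  have hK0 : (0 : ℝ) < epsK ε := by exact_mod_cast epsK_pos ε
  have h4 : 0 < ε ^ 4 := by positivity
  positivity

/-! ## Monotonicity in the Peierls constant: a better (larger) admissible `ε` can only raise the defect -/

/-- `K` is antitone on `(0, 8]`: `0 < ε ≤ ε' ≤ 8 ⇒ K(ε') ≤ K(ε)`. [folklore] -/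
theorem epsK_antitone {ε ε' : ℝ} (hε : 0 < ε) (hle : ε ≤ ε') (h8 : ε' ≤ 8) : epsK ε' ≤ epsK ε := by
  unfold epsK
  have hε' : 0 < ε' := lt_of_lt_of_le hε hle
  have hlog' : 0 ≤ Real.log (8 / ε') := Real.log_nonneg (by rw [le_div_iff₀ hε']; linarith)
  have hlog : Real.log (8 / ε') ≤ Real.log (8 / ε) :=
    Real.log_le_log (by positivity) (div_le_div_of_nonneg_left (by norm_num) hε hle)
  have h32 : 32 / ε' ≤ 32 / ε := div_le_div_of_nonneg_left (by norm_num) hε hle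
  have hprod : Real.log (8 / ε') * (32 / ε') ≤ Real.log (8 / ε) * (32 / ε) :=
    mul_le_mul hlog h32 (by positivity) (hlog'.trans hlog)
  exact max_le_max_left 64 (Nat.ceil_mono hprod)

/-- **`τ_U` is monotone in `ε` on `(0, 8]`** (`d ≥ 1`): `0 < ε ≤ ε' ≤ 8 ⇒ τ_U(ε, d) ≤ τ_U(ε', d)`. [folklore] -/
theorem epsTauU_mono (hd : 1 ≤ d) {ε ε' : ℝ} (hε : 0 < ε) (hle : ε ≤ ε') (h8 : ε' ≤ 8) :
    epsTauU ε d ≤ epsTauU ε' d := by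
  rw [epsTauU_eq_closedForm hd, epsTauU_eq_closedForm hd]
  have hK : (epsK ε' : ℝ) ≤ epsK ε := by exact_mod_cast epsK_antitone hε hle h8
  have hK0 : (0 : ℝ) < epsK ε' := by exact_mod_cast epsK_pos ε'
  have hd0 : (0 : ℝ) < 96 * ((d : ℝ) + 1) := by positivity
  have hnum : ε ^ 4 ≤ ε' ^ 4 := pow_le_pow_left₀ hε.le hle 4
  have hden : 2 * (96 * ((d : ℝ) + 1)) ^ 4 * (200 * (epsK ε' : ℝ)) ^ 2 ≤
      2 * (96 * ((d : ℝ) + 1)) ^ 4 * (200 * (epsK ε : ℝ)) ^ 2 := by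
    have : (200 * (epsK ε' : ℝ)) ^ 2 ≤ (200 * (epsK ε : ℝ)) ^ 2 :=
      pow_le_pow_left₀ (by positivity) (by linarith) 2
    exact mul_le_mul_of_nonneg_left this (by positivity)
  exact div_le_div₀ (by positivity) hnum (by positivity) hden

/-- The orbit defect is monotone in `ε` on `(0, 8]` (`d ≥ 1`). [folklore] -/
theorem epsOrbitDefect_mono (hd : 1 ≤ d) {ε ε' : ℝ} (hε : 0 < ε) (hle : ε ≤ ε') (h8 : ε' ≤ 8) :
    epsOrbitDefect ε d ≤ epsOrbitDefect ε' d :=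
  pow_le_pow_left₀ (epsTauU_pos hd hε.ne').le (epsTauU_mono hd hε hle h8) _

/-! ## The bracket at dyadic `ε = 2⁻ᵃ` -/

/-- The argument of the ceiling at `ε = 2⁻ᵃ`: `log(8/ε)·32/ε = (a+3)·2^{a+5}·log 2`. [folklore] -/
theorem epsK_arg_half_pow (a : ℕ) :
    Real.log (8 / (1 / 2 : ℝ) ^ a) * (32 / (1 / 2 : ℝ) ^ a) = ((a : ℝ) + 3) * 2 ^ (a + 5) * Real.log 2 := by
  have h2 : (0 : ℝ) < 2 ^ a := by positivity
  have h8 : (8 : ℝ) / (1 / 2 : ℝ) ^ a = 2 ^ (a + 3) := by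
    rw [one_div_pow, div_div_eq_mul_div, div_one, pow_add]; norm_num; ring
  have h32 : (32 : ℝ) / (1 / 2 : ℝ) ^ a = 2 ^ (a + 5) := by
    rw [one_div_pow, div_div_eq_mul_div, div_one, pow_add]; norm_num; ring
  rw [h8, h32, Real.log_pow]
  push_cast
  ring

/-- **`K(2⁻ᵃ) ≤ (a+3)·2^{a+5}`** (from `log 2 < 1`). [folklore] -/
theorem epsK_half_pow_le (a : ℕ) : epsK ((1 / 2 : ℝ) ^ a) ≤ (a + 3) * 2 ^ (a + 5) := by
  unfold epsK
  refine max_le ?_ ?_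
  · calc (64 : ℕ) ≤ 3 * 2 ^ 5 := by norm_num
      _ ≤ (a + 3) * 2 ^ (a + 5) := Nat.mul_le_mul (by omega) (Nat.pow_le_pow_right (by norm_num) (by omega))
  · rw [Nat.ceil_le, epsK_arg_half_pow]
    have hhi := Real.log_two_lt_d9
    have h0 : (0 : ℝ) ≤ ((a : ℝ) + 3) * 2 ^ (a + 5) := by positivity
    have : ((a : ℝ) + 3) * 2 ^ (a + 5) * Real.log 2 ≤ ((a : ℝ) + 3) * 2 ^ (a + 5) * 1 :=
      mul_le_mul_of_nonneg_left (by linarith) h0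
    push_cast
    linarith

/-- **`(a+3)·2^{a+4} < K(2⁻ᵃ)`** (from `1/2 < log 2`). [folklore] -/
theorem lt_epsK_half_pow (a : ℕ) : (a + 3) * 2 ^ (a + 4) < epsK ((1 / 2 : ℝ) ^ a) := by
  unfold epsK
  refine lt_of_lt_of_le ?_ (le_max_right _ _)
  rw [Nat.lt_ceil, epsK_arg_half_pow]
  have hlo := Real.log_two_gt_d9
  have h0 : (0 : ℝ) < ((a : ℝ) + 3) * 2 ^ (a + 4) := by positivity
  have : ((a : ℝ) + 3) * 2 ^ (a + 5) * Real.log 2 = ((a : ℝ) + 3) * 2 ^ (a + 4) * (2 * Real.log 2) := by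
    rw [pow_succ]; ring
  rw [this]
  push_cast
  nlinarith

/-- **Upper bracket of the uniqueness tolerance at `ε = 2⁻ᵃ`**, every `a`, `d ≥ 1`:
`τ_U(2⁻ᵃ, d) ≤ 2^{-(6a+50)} / ((d+1)⁴·(a+3)²)`. [folklore] -/
theorem epsTauU_half_pow_le (hd : 1 ≤ d) (a : ℕ) :
    epsTauU ((1 / 2 : ℝ) ^ a) d ≤ (1 / 2 : ℝ) ^ (6 * a + 50) / ((((d : ℝ) + 1) ^ 4) * ((a : ℝ) + 3) ^ 2) := by
  rw [epsTauU_eq_closedForm hd]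
  have hK : ((a : ℝ) + 3) * 2 ^ (a + 4) < (epsK ((1 / 2 : ℝ) ^ a) : ℝ) := by exact_mod_cast lt_epsK_half_pow a
  have hK0 : (0 : ℝ) < ((a : ℝ) + 3) * 2 ^ (a + 4) := by positivity
  have hd0 : (0 : ℝ) < (d : ℝ) + 1 := by positivity
  -- replace `K` by its lower bound in the denominator
  have hden : 2 * (96 * ((d : ℝ) + 1)) ^ 4 * (200 * (((a : ℝ) + 3) * 2 ^ (a + 4))) ^ 2 ≤
      2 * (96 * ((d : ℝ) + 1)) ^ 4 * (200 * (epsK ((1 / 2 : ℝ) ^ a) : ℝ)) ^ 2 := by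
    have : (200 * (((a : ℝ) + 3) * 2 ^ (a + 4))) ^ 2 ≤ (200 * (epsK ((1 / 2 : ℝ) ^ a) : ℝ)) ^ 2 :=
      pow_le_pow_left₀ (by positivity) (by linarith) 2
    exact mul_le_mul_of_nonneg_left this (by positivity)
  refine (div_le_div_of_nonneg_left (by positivity) (by positivity) hden).trans ?_
  -- pure arithmetic: `2⁻⁴ᵃ / (2·96⁴(d+1)⁴·200²·(a+3)²·2^{2a+8}) ≤ 2^{-(6a+50)} / ((d+1)⁴ (a+3)²)` since `2¹⁵ ≤ 50625`
  rw [div_le_div_iff₀ (by positivity) (by positivity)]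
  have e1 : ((1 / 2 : ℝ) ^ a) ^ 4 * 2 ^ (6 * a + 50) = 2 ^ (2 * a + 50) := by
    rw [← pow_mul, show 6 * a + 50 = a * 4 + (2 * a + 50) by ring, pow_add, ← mul_assoc, ← mul_pow]
    norm_num
  have e2 : (2 : ℝ) ^ (2 * a + 50) = 2 ^ 42 * (2 ^ (a + 4)) ^ 2 := by
    rw [← pow_mul, ← pow_add]; ring_nf
  have key : ((1 / 2 : ℝ) ^ a) ^ 4 * ((((d : ℝ) + 1) ^ 4) * ((a : ℝ) + 3) ^ 2) * 2 ^ (6 * a + 50) ≤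
      2 * (96 * ((d : ℝ) + 1)) ^ 4 * (200 * (((a : ℝ) + 3) * 2 ^ (a + 4))) ^ 2 := by
    have hP : (0 : ℝ) ≤ (((d : ℝ) + 1) ^ 4) * ((a : ℝ) + 3) ^ 2 * (2 ^ (a + 4)) ^ 2 := by positivity
    calc ((1 / 2 : ℝ) ^ a) ^ 4 * ((((d : ℝ) + 1) ^ 4) * ((a : ℝ) + 3) ^ 2) * 2 ^ (6 * a + 50)
        = 2 ^ 42 * ((((d : ℝ) + 1) ^ 4) * ((a : ℝ) + 3) ^ 2 * (2 ^ (a + 4)) ^ 2) := by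
          rw [mul_comm, ← mul_assoc, mul_comm (2 ^ (6 * a + 50) : ℝ), e1, e2]; ring
      _ ≤ (2 * 96 ^ 4 * 200 ^ 2) * ((((d : ℝ) + 1) ^ 4) * ((a : ℝ) + 3) ^ 2 * (2 ^ (a + 4)) ^ 2) :=
          mul_le_mul_of_nonneg_right (by norm_num) hP
      _ = 2 * (96 * ((d : ℝ) + 1)) ^ 4 * (200 * (((a : ℝ) + 3) * 2 ^ (a + 4))) ^ 2 := by ring
  have h2pos : (0 : ℝ) < 2 ^ (6 * a + 50) := by positivity
  calc ((1 / 2 : ℝ) ^ a) ^ 4 * ((((d : ℝ) + 1) ^ 4) * ((a : ℝ) + 3) ^ 2)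
      = ((1 / 2 : ℝ) ^ a) ^ 4 * ((((d : ℝ) + 1) ^ 4) * ((a : ℝ) + 3) ^ 2) * 2 ^ (6 * a + 50) * (1 / 2 : ℝ) ^ (6 * a + 50) := by
        rw [mul_assoc _ (2 ^ (6 * a + 50) : ℝ), ← mul_pow]; norm_num
    _ ≤ 2 * (96 * ((d : ℝ) + 1)) ^ 4 * (200 * (((a : ℝ) + 3) * 2 ^ (a + 4))) ^ 2 * (1 / 2 : ℝ) ^ (6 * a + 50) :=
        mul_le_mul_of_nonneg_right key (by positivity)
    _ = (1 / 2 : ℝ) ^ (6 * a + 50) * (2 * (96 * ((d : ℝ) + 1)) ^ 4 * (200 * (((a : ℝ) + 3) * 2 ^ (a + 4))) ^ 2) := by ring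

/-- **Lower bracket of the uniqueness tolerance at `ε = 2⁻ᵃ`**, every `a`, `d ≥ 1`:
`2^{-(6a+53)} / ((d+1)⁴·(a+3)²) ≤ τ_U(2⁻ᵃ, d)`. [folklore] -/
theorem le_epsTauU_half_pow (hd : 1 ≤ d) (a : ℕ) :
    (1 / 2 : ℝ) ^ (6 * a + 53) / ((((d : ℝ) + 1) ^ 4) * ((a : ℝ) + 3) ^ 2) ≤ epsTauU ((1 / 2 : ℝ) ^ a) d := by
  rw [epsTauU_eq_closedForm hd]
  have hK : (epsK ((1 / 2 : ℝ) ^ a) : ℝ) ≤ ((a : ℝ) + 3) * 2 ^ (a + 5) := by exact_mod_cast epsK_half_pow_le a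
  have hK0 : (0 : ℝ) < (epsK ((1 / 2 : ℝ) ^ a) : ℝ) := by exact_mod_cast epsK_pos _
  have hd0 : (0 : ℝ) < (d : ℝ) + 1 := by positivity
  -- replace `K` by its upper bound in the denominator
  have hden : 2 * (96 * ((d : ℝ) + 1)) ^ 4 * (200 * (epsK ((1 / 2 : ℝ) ^ a) : ℝ)) ^ 2 ≤
      2 * (96 * ((d : ℝ) + 1)) ^ 4 * (200 * (((a : ℝ) + 3) * 2 ^ (a + 5))) ^ 2 := by
    have : (200 * (epsK ((1 / 2 : ℝ) ^ a) : ℝ)) ^ 2 ≤ (200 * (((a : ℝ) + 3) * 2 ^ (a + 5))) ^ 2 :=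
      pow_le_pow_left₀ (by positivity) (by linarith) 2
    exact mul_le_mul_of_nonneg_left this (by positivity)
  refine le_trans ?_ (div_le_div_of_nonneg_left (by positivity) (by positivity) hden)
  -- pure arithmetic: `2^{-(6a+53)} / ((d+1)⁴ (a+3)²) ≤ 2⁻⁴ᵃ / (2·96⁴(d+1)⁴·200²·(a+3)²·2^{2a+10})` since `50625 ≤ 2¹⁶`
  rw [div_le_div_iff₀ (by positivity) (by positivity)]
  have e1 : (1 / 2 : ℝ) ^ (6 * a + 53) * 2 ^ (2 * a + 53) = ((1 / 2 : ℝ) ^ a) ^ 4 := by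
    rw [← pow_mul, show 6 * a + 53 = (2 * a + 53) + a * 4 by ring, pow_add, mul_right_comm, ← mul_pow]
    norm_num
  have e2 : (2 : ℝ) ^ (2 * a + 53) = 2 ^ 43 * (2 ^ (a + 5)) ^ 2 := by
    rw [← pow_mul, ← pow_add]; ring_nf
  have h2pos : (0 : ℝ) < 2 ^ (2 * a + 53) := by positivity
  have key : (2 * (96 * ((d : ℝ) + 1)) ^ 4 * (200 * (((a : ℝ) + 3) * 2 ^ (a + 5))) ^ 2) ≤
      2 ^ (2 * a + 53) * ((((d : ℝ) + 1) ^ 4) * ((a : ℝ) + 3) ^ 2) := by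
    have hP : (0 : ℝ) ≤ (((d : ℝ) + 1) ^ 4) * ((a : ℝ) + 3) ^ 2 * (2 ^ (a + 5)) ^ 2 := by positivity
    calc (2 * (96 * ((d : ℝ) + 1)) ^ 4 * (200 * (((a : ℝ) + 3) * 2 ^ (a + 5))) ^ 2)
        = (2 * 96 ^ 4 * 200 ^ 2) * ((((d : ℝ) + 1) ^ 4) * ((a : ℝ) + 3) ^ 2 * (2 ^ (a + 5)) ^ 2) := by ring
      _ ≤ 2 ^ 43 * ((((d : ℝ) + 1) ^ 4) * ((a : ℝ) + 3) ^ 2 * (2 ^ (a + 5)) ^ 2) :=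
          mul_le_mul_of_nonneg_right (by norm_num) hP
      _ = 2 ^ (2 * a + 53) * ((((d : ℝ) + 1) ^ 4) * ((a : ℝ) + 3) ^ 2) := by rw [e2]; ring
  calc (1 / 2 : ℝ) ^ (6 * a + 53) * (2 * (96 * ((d : ℝ) + 1)) ^ 4 * (200 * (((a : ℝ) + 3) * 2 ^ (a + 5))) ^ 2)
      ≤ (1 / 2 : ℝ) ^ (6 * a + 53) * (2 ^ (2 * a + 53) * ((((d : ℝ) + 1) ^ 4) * ((a : ℝ) + 3) ^ 2)) :=
        mul_le_mul_of_nonneg_left key (by positivity)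
    _ = ((1 / 2 : ℝ) ^ a) ^ 4 * ((((d : ℝ) + 1) ^ 4) * ((a : ℝ) + 3) ^ 2) := by rw [← mul_assoc, e1]

/-- **THE BRACKET OF THE ORBIT DEFECT AT `ε = 2⁻ᵃ`** (every `a`, every `d ≥ 1`):
`(2^{-(6a+53)}/((d+1)⁴(a+3)²))^{d·2^d} ≤ η(2⁻ᵃ, d) ≤ (2^{-(6a+50)}/((d+1)⁴(a+3)²))^{d·2^d}`, i.e.
`log₂(1/η_d(2⁻ᵃ)) = d·2^d·(6a + 2log₂(a+3) + 4log₂(d+1) + θ)`, `θ ∈ [50, 53]`: six bits of base per bit of Peierls constant, times `d·2^d`.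
builds on p205010 (kernel theorem, internal audit signed; external expert review pending). [folklore] -/
theorem epsOrbitDefect_half_pow_bracket (hd : 1 ≤ d) (a : ℕ) :
    ((1 / 2 : ℝ) ^ (6 * a + 53) / ((((d : ℝ) + 1) ^ 4) * ((a : ℝ) + 3) ^ 2)) ^ (d * 2 ^ d) ≤ epsOrbitDefect ((1 / 2 : ℝ) ^ a) d ∧
      epsOrbitDefect ((1 / 2 : ℝ) ^ a) d ≤ ((1 / 2 : ℝ) ^ (6 * a + 50) / ((((d : ℝ) + 1) ^ 4) * ((a : ℝ) + 3) ^ 2)) ^ (d * 2 ^ d) :=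
  ⟨pow_le_pow_left₀ (by positivity) (le_epsTauU_half_pow hd a) _,
    pow_le_pow_left₀ (epsTauU_pos hd (by positivity)).le (epsTauU_half_pow_le hd a) _⟩

/-! ## What any future Peierls threshold buys (the levers table as one statement) -/

/-- **Any admissible Peierls constant `ε ∈ [2⁻ᵃ, 8]` gives a defect at least the `a`-bracket**:
`(2^{-(6a+53)}/((d+1)⁴(a+3)²))^{d·2^d} ≤ η(ε, d)` (`d ≥ 1`).  With a driver percolating at threshold `ε` this is the base the
cascade prints; e.g. `ε = 2⁻⁸` (arm-1's `★`-animal driver) ⇒ `log₂(1/η₃) ≤ 24·(48 + 53 + 8 + 2log₂ 11) < 2782` (certified value `2747.7`,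
p245966), and `ε = 2⁻³²` ⇒ `< 6318` (certified `6283.9`, p213333).  Class of the rate unchanged. [folklore] -/
theorem epsOrbitDefect_ge_of_le (hd : 1 ≤ d) (a : ℕ) {ε : ℝ} (hε : (1 / 2 : ℝ) ^ a ≤ ε) (h8 : ε ≤ 8) :
    ((1 / 2 : ℝ) ^ (6 * a + 53) / ((((d : ℝ) + 1) ^ 4) * ((a : ℝ) + 3) ^ 2)) ^ (d * 2 ^ d) ≤ epsOrbitDefect ε d :=
  (epsOrbitDefect_half_pow_bracket hd a).1.trans (epsOrbitDefect_mono hd (by positivity) hε h8)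

/-- **Instance check, `d = 3`, tree threshold `ε = 2⁻³²`**: `(2⁻²⁴⁵/(256·1225))^24 ≤ knTauU 3^24 ≤ (2⁻²⁴²/(256·1225))^24`
(the certified value `2⁻⁶²⁸³·⁹` lies inside: `24·(245 + 8 + log₂ 1225) = 6318.4`, `24·(242 + 18.26) = 6246.2`). [folklore] -/
theorem knOrbit_three_bracket :
    ((1 / 2 : ℝ) ^ 245 / (256 * 1225)) ^ 24 ≤ knTauU 3 ^ 24 ∧ knTauU 3 ^ 24 ≤ ((1 / 2 : ℝ) ^ 242 / (256 * 1225)) ^ 24 := by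
  have h := epsOrbitDefect_half_pow_bracket (d := 3) (by norm_num) 32
  rw [knTauU_three_pow_eq, knEps_eq]
  norm_num at h ⊢
  exact h

/-- **Instance check, `d = 3`, the Peierls lever `ε = 2⁻⁸`**: `(2⁻¹⁰¹/(256·121))^24 ≤ pkTauU 3^24 ≤ (2⁻⁹⁸/(256·121))^24`
(the certified value `2⁻²⁷⁴⁷·⁷` lies inside: `24·(101 + 8 + log₂ 121) = 2782.1`, `24·(98 + 14.92) = 2710.1`). [folklore] -/
theorem pkOrbit_three_bracket :
    ((1 / 2 : ℝ) ^ 101 / (256 * 121)) ^ 24 ≤ pkTauU 3 ^ 24 ∧ pkTauU 3 ^ 24 ≤ ((1 / 2 : ℝ) ^ 98 / (256 * 121)) ^ 24 := by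
  have h := epsOrbitDefect_half_pow_bracket (d := 3) (by norm_num) 8
  rw [pkTauU_three_pow_eq, pkEps_eq]
  norm_num at h ⊢
  exact h

/-! ## The ceiling of the lever (appended by arm-2 gen 3): no Peierls constant whatsoever lifts the defect above the `a = 0` bracket -/

/-- **CEILING OF THE PEIERLS LEVER** (`d ≥ 1`): for EVERY Peierls constant `0 < ε ≤ 1` the orbit defect of the cascade satisfies
`η(ε, d) ≤ (2⁻⁵⁰/(9·(d+1)⁴))^{d·2^d}` (monotonicity up to `ε = 1`, then the `a = 0` bracket).  What remains after the Peierls constant is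
optimised away is structural to the scheme: the two Markov squares, the corridor/chain constants `96(d+1)`, `200·K ≥ 200·64`, and the orbit
exponent `d·2^d`.  builds on p205010 (kernel theorem, internal audit signed; external expert review pending). [folklore] -/
theorem epsOrbitDefect_le_ceiling (hd : 1 ≤ d) {ε : ℝ} (hε : 0 < ε) (h1 : ε ≤ 1) :
    epsOrbitDefect ε d ≤ ((1 / 2 : ℝ) ^ 50 / ((((d : ℝ) + 1) ^ 4) * 9)) ^ (d * 2 ^ d) := by
  have hmono : epsOrbitDefect ε d ≤ epsOrbitDefect ((1 / 2 : ℝ) ^ 0) d := by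
    rw [pow_zero]; exact epsOrbitDefect_mono hd hε h1 (by norm_num)
  have h0 := (epsOrbitDefect_half_pow_bracket hd 0).2
  refine hmono.trans (h0.trans (le_of_eq ?_))
  norm_num

/-- Numeral form of the ceiling: `2^E ≤ (2⁵⁰·D)^k` (an integer fact) gives `((1/2)⁵⁰/D)^k ≤ (1/2)^E` over `ℝ`. [folklore] (numeric) -/
theorem ceiling_numeral_aux {D E : ℕ} (k : ℕ) (h : 2 ^ E ≤ (2 ^ 50 * D) ^ k) :
    ((1 / 2 : ℝ) ^ 50 / (D : ℝ)) ^ k ≤ (1 / 2 : ℝ) ^ E := by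
  have e1 : ((1 / 2 : ℝ) ^ 50 / (D : ℝ)) ^ k = 1 / (((2 ^ 50 * D) ^ k : ℕ) : ℝ) := by
    rw [one_div_pow, div_div, one_div_pow]; push_cast; ring
  have e2 : (1 / 2 : ℝ) ^ E = 1 / ((2 ^ E : ℕ) : ℝ) := by rw [Nat.cast_pow, Nat.cast_ofNat, one_div_pow]
  rw [e1, e2]
  have hpos : (0 : ℝ) < ((2 ^ E : ℕ) : ℝ) := by positivity
  exact one_div_le_one_div_of_le hpos (by exact_mod_cast h)

/-- **`d = 3`: no Peierls constant prints a base below `1 − 2⁻¹⁴⁶⁸`** — `η(ε, 3) ≤ 2⁻¹⁴⁶⁸` for every `0 < ε ≤ 1`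
(`24·(50 + 8 + log₂ 9) = 1468.08`; compare the tree's `2⁻⁶²⁸⁴` at `ε = 2⁻³²` and the lever's `2⁻²⁷⁴⁸` at `ε = 2⁻⁸`). [folklore] (numeric) -/
theorem epsOrbitDefect_three_le_ceiling {ε : ℝ} (hε : 0 < ε) (h1 : ε ≤ 1) : epsOrbitDefect ε 3 ≤ (1 / 2 : ℝ) ^ 1468 := by
  refine (epsOrbitDefect_le_ceiling (by norm_num) hε h1).trans ?_
  have hD : (((3 : ℕ) : ℝ) + 1) ^ 4 * 9 = ((2304 : ℕ) : ℝ) := by norm_num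
  rw [hD]
  exact ceiling_numeral_aux (3 * 2 ^ 3) (by decide +kernel)

/-- **`d = 4`**: `η(ε, 4) ≤ 2⁻³⁹⁹⁷` for every `0 < ε ≤ 1` (`64·(50 + 4log₂5 + log₂9) = 3997.3`). [folklore] (numeric) -/
theorem epsOrbitDefect_four_le_ceiling {ε : ℝ} (hε : 0 < ε) (h1 : ε ≤ 1) : epsOrbitDefect ε 4 ≤ (1 / 2 : ℝ) ^ 3997 := by
  refine (epsOrbitDefect_le_ceiling (by norm_num) hε h1).trans ?_
  have hD : (((4 : ℕ) : ℝ) + 1) ^ 4 * 9 = ((5625 : ℕ) : ℝ) := by norm_num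
  rw [hD]
  exact ceiling_numeral_aux (4 * 2 ^ 4) (by decide +kernel)

/-- **`d = 5`**: `η(ε, 5) ≤ 2⁻¹⁰¹⁶¹` for every `0 < ε ≤ 1` (`160·(50 + 4log₂6 + log₂9) = 10161.6`). [folklore] (numeric) -/
theorem epsOrbitDefect_five_le_ceiling {ε : ℝ} (hε : 0 < ε) (h1 : ε ≤ 1) : epsOrbitDefect ε 5 ≤ (1 / 2 : ℝ) ^ 10161 := by
  refine (epsOrbitDefect_le_ceiling (by norm_num) hε h1).trans ?_
  have hD : (((5 : ℕ) : ℝ) + 1) ^ 4 * 9 = ((11664 : ℕ) : ℝ) := by norm_num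
  rw [hD]
  exact ceiling_numeral_aux (5 * 2 ^ 5) (by decide +kernel)

/-- **`d = 6`**: `η(ε, 6) ≤ 2⁻²⁴⁷²⁹` for every `0 < ε ≤ 1` (`384·(50 + 4log₂7 + log₂9) = 24729.3`). [folklore] (numeric) -/
theorem epsOrbitDefect_six_le_ceiling {ε : ℝ} (hε : 0 < ε) (h1 : ε ≤ 1) : epsOrbitDefect ε 6 ≤ (1 / 2 : ℝ) ^ 24729 := by
  refine (epsOrbitDefect_le_ceiling (by norm_num) hε h1).trans ?_
  have hD : (((6 : ℕ) : ℝ) + 1) ^ 4 * 9 = ((21609 : ℕ) : ℝ) := by norm_num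
  rw [hD]
  exact ceiling_numeral_aux (6 * 2 ^ 6) (by decide +kernel)

end Summit.CriticalPhenomena.PercolationContinuityZ3.Theorems.Quant

end
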